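import Summits.QuantumFields.YangMills.Theorems.LuscherReductionTwistedTraceScalingShellAssemblyFixed
import Summits.QuantumFields.YangMills.Theorems.LuscherReductionTwistedTraceScalingInnerOfSoftTube
import Summits.QuantumFields.YangMills.Theorems.LuscherReductionTwistedTraceScalingShellOneOrbit
import Summits.QuantumFields.YangMills.Theorems.LuscherReductionTwistedTraceScalingOneSiteAnnulusGain
import HarnessLib

/-!
# ★★★ THE SHELL ASSEMBLY, part 2: a thin C4-SHELL gain `ShellGainOneOrbitAt` ⟸ its brick list `ShellBricks` (a SUP-version BO package on the tube of the OUTER slow radius)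
# (lane A of S-BASE, crux `TwistedTraceScaling` stmt-QuantumFields-20203, line «twolattice», stub `stub_fixedLatticeTraceLaw`; lead g23; card `pub/ym-fleet/ym-luscher-20007-p1/Lines-shell-gain.md` §3)

* structure `ShellBricks L χ δc δ` = ✓`BOBricks` WITHOUT `hκ_small`/`hb_small`/`hcore`, WITH: the one-site annulus radius `t β ∈ [(L³β)^{−1/5}, 1/5000]`, the INNER SHADOW
  (`Ω β (linkEmbed v) ≠ 0 → δc β/2 < orbitDist (orthoTube u v) → 6·t β ≤ orbitDist₁ u`), the FLOOR `e^{−λ_b}σμ₀ ≤ λ₀` (the C4-CORE record supplies it with the same `σ`), the DOMINATION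
  `A·λ_b + 6κ + 2b²/θ₀ ≤ t√t/80 ∧ A·λ_b ≤ θ₀/2` eventually for every `A`, and `SoftTubeAdmissible L δ χ`;
* `boCoeff_inner_support` — the BO amplitude of an `f` living in `{δc/2 < orbitDist}` lives in the one-site annulus `{6t ≤ orbitDist₁}`;
* ★★★ `softTubeGain_of_shellBricks` — for every `A`, eventually in `β`: `T(f) ≤ e^{−Aλ_b(L³β)}·λ₀·‖f‖²_{N/χ}` for bounded measurable `f` supported in `supp χ ∩ {orbitDist < δ} ∩ {δc/2 < orbitDist}`
  (✓`shell_gain_fixed` fed with ✓`oneSite_annulus_gain_orbitDist` at `B = L³β`, then `σμ₀(1 − m) ≤ σμ₀e^{−m} ≤ e^{λ_b}λ₀e^{−(|A|+1)λ_b}`);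
* ★★★ `shellGainOneOrbitAt_of_shellBricks : ShellBricks L χ δc δ → ShellGainOneOrbitAt L δc δ η` (every `η`; slice reduction as in ✓`innerNoIntruderOneOrbitAt_of_softTube`);
* ★★★ `innerShellGainSmallAt_of_shellBricks` — polynomial radii: `ShellBricks L χ (β^{−a}) (β^{−b}) → InnerShellGainSmallAt L (β^{−a}) (β^{−b}) (β^{−q})` (`0 < b`).
With ✓`valleyGainAt_pow_of_shellSmall`, RED's ✓`valleyGainAt_ledger` and ✓`coarseUpper_of_valleyGain`: a chain of thin shells `(a_i, a_{i+1})`, `a_{i+1} < a_i < (4/3)a_{i+1}`, from `1/40` up to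
`s ∈ (1/6,1/5)` gives COARSE-UPPER(L).
HONEST FRAMING: the assembly is PROVED; the bricks at slow radius `β^{−b}`, `b ≤ 1/6` ((B-ST)_b, (B-OD)_b) are OPEN ((B-T)_b ✓`profileB_hT`, floor, one-site gain, copies are in the tree);
C4-SHELL, COARSE-UPPER/LOWER/TAIL, the stubs and the crux stay OPEN; CONDITIONAL route R2b1; not infinite volume, not a mass gap, not Clay.  One structure (a hypothesis list), no `sorry`.
-/

set_option autoImplicit false

noncomputable section

open MeasureTheory Filter Topology Real
open scoped BigOperators
open Literature.MathematicalPhysics.QuantumFieldTheory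
open Literature.MathematicalPhysics.QuantumLattice

namespace Summit.QuantumFields.YangMills.Theorems.FemtoTransferGap.TwoLattice.ConstTube

open Summit.QuantumFields.YangMills.Theorems.FemtoTransferGap
open Summit.QuantumFields.YangMills.Theorems.FemtoTransferGap.TwoLattice.Avg
open Summit.QuantumFields.YangMills.Theorems.FemtoTransferGap.TwoLattice.Stiff (LinkSpace)

variable {L : ℕ} [NeZero L]

/-! ## §4 The brick list of a thin shell and the eventual assembly -/

variable (L) in
/-- **THE BRICK LIST OF A THIN C4-SHELL** on the soft tube `χ` (slow radius = the OUTER radius `δ`) with inner radius `δc`: ✓`BOBricks` without the `o(λ_b)` smallness of the rates and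
without the core window, with: the one-site annulus radius `t`, the INNER SHADOW, the FLOOR in `σμ₀`-currency, the DOMINATION of the rates by the annulus gain, and soft-tube admissibility.
A hypothesis list (target = its instances at `(δc, δ) = (β^{−a}, β^{−b})`, `b < a < 4b/3`), not a theorem. [cite: Luscher1983, §3] [cite: SjostrandZworski2007, §2] -/
structure ShellBricks (χ : ℝ → GaugeConfig 3 L SU2 → ℝ) (δc δ : ℝ → ℝ) where
  /-- fibre profile -/
  Ω : ℝ → LinkSpace L → ℝ
  /-- slow window -/
  𝒰 : ℝ → Set (GaugeConfig 3 1 SU2)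
  /-- fibre energy factor, fibre mass, relative fibre error, off-diagonal rate, one-site annulus radius, one-site window radius -/
  σ : ℝ → ℝ
  γ : ℝ → ℝ
  κ : ℝ → ℝ
  b : ℝ → ℝ
  t : ℝ → ℝ
  δ₁ : ℝ → ℝ
  /-- stiff gap -/
  θ₀ : ℝ
  -- structural hypotheses
  hadm : SoftTubeAdmissible L δ χ
  hwm : ∀ β, Measurable (softWeight (χ β))
  hwb : ∀ β, ∃ Cw : ℝ, ∀ U, |softWeight (χ β) U| ≤ Cw
  hw0 : ∀ β U, 0 ≤ softWeight (χ β) U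
  hwinv : ∀ β (g : SU2) (U : GaugeConfig 3 L SU2), softWeight (χ β) (gaugeTransform (fun _ : Site 3 L => g) U) = softWeight (χ β) U
  hΩm : ∀ β, Measurable (Ω β)
  hΩ1 : ∀ β x, |Ω β x| ≤ 1
  hΩinv : ∀ β (g : SU2) (v : LinkSpace L), Ω β (adL L g v) = Ω β v
  h𝒰m : ∀ β, MeasurableSet (𝒰 β)
  h𝒰inv : ∀ β (g : SU2) (u : GaugeConfig 3 1 SU2), gaugeTransform (fun _ : Site 3 1 => g) u ∈ 𝒰 β ↔ u ∈ 𝒰 β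
  h𝒰δ₁ : ∀ β, ∀ u ∈ 𝒰 β, orbitDist u < δ₁ β
  hδ₁ : ∀ᶠ β in atTop, δ₁ β ≤ 1 / 2
  hshadow : ∀ᶠ β in atTop, ∀ U, χ β U ≠ 0 → orbitDist U < δ β → slowMean L U ∈ 𝒰 β
  hshadowIn : ∀ᶠ β in atTop, ∀ (u : GaugeConfig 3 1 SU2) (v : Edge 3 L → Fin 3 → ℝ), v ∈ capBalancedSet L → Ω β (linkEmbed L v) ≠ 0 →
    δc β / 2 < orbitDist (orthoTube L u v) → 6 * t β ≤ orbitDist u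
  hbo : ∀ᶠ β in atTop, ∀ (φ : GaugeConfig 3 1 SU2 → ℝ) (U : GaugeConfig 3 L SU2), (∀ u, φ u ≠ 0 → u ∈ 𝒰 β) → boFun L φ (Ω β) U ≠ 0 → χ β U ≠ 0
  ht : ∀ᶠ β in atTop, ((L : ℝ) ^ 3 * β) ^ (-(1 / 5 : ℝ)) ≤ t β ∧ t β ≤ 1 / 5000
  hσ : ∀ β, 0 < σ β
  hγ : ∀ β, 0 < γ β
  hκ : ∀ β, 0 ≤ κ β
  hb : ∀ β, 0 ≤ b β
  hθ₀ : 0 < θ₀ ∧ θ₀ ≤ 1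
  /-- FLOOR in `σμ₀`-currency (the C4-CORE record supplies it with the same `σ`) -/
  hfloor : ∀ᶠ β in atTop, Real.exp (-(bareLambda ((L : ℝ) ^ 3 * β))) * (σ β * levelValue su2Rep 1 ((L : ℝ) ^ 3 * β) 0) ≤ levelValue su2Rep L β 0
  /-- DOMINATION: every multiple of `λ_b` and the rates are below the one-site annulus gain `t√t/80`, and below half the stiff gap -/
  hdom : ∀ A : ℝ, ∀ᶠ β in atTop, A * bareLambda ((L : ℝ) ^ 3 * β) + 6 * κ β + 2 * b β ^ 2 / θ₀ ≤ t β * Real.sqrt (t β) / 80 ∧ A * bareLambda ((L : ℝ) ^ 3 * β) ≤ θ₀ / 2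
  -- the analytic bricks
  hN : ∀ᶠ β in atTop, ∀ u ∈ 𝒰 β, |fibreMass L (softWeight (χ β)) (Ω β) u - γ β| ≤ κ β * γ β
  hT : ∀ᶠ β in atTop, ∀ φ : GaugeConfig 3 1 SU2 → ℝ, Measurable φ → (∃ C : ℝ, ∀ u, |φ u| ≤ C) →
    (∀ (g : Site 3 1 → SU2) (u : GaugeConfig 3 1 SU2), φ (gaugeTransform g u) = φ u) → (∀ u, φ u ≠ 0 → u ∈ 𝒰 β) →
    |tubeForm β (boFun L φ (Ω β)) - σ β * γ β * qform su2Rep ((L : ℝ) ^ 3 * β) φ φ| ≤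
      κ β * (σ β * γ β) * (qform su2Rep ((L : ℝ) ^ 3 * β) φ φ + levelValue su2Rep 1 ((L : ℝ) ^ 3 * β) 0 * l2 φ φ)
  hST : ∀ᶠ β in atTop, ∀ v : GaugeConfig 3 L SU2 → ℝ, Measurable v → (∃ C : ℝ, ∀ U, |v U| ≤ C) → (∀ U, v U ≠ 0 → χ β U ≠ 0) →
    (∀ u, fibreInner L (softWeight (χ β)) (Ω β) v u = 0) →
    tubeForm β v ≤ (1 - θ₀) * (σ β * levelValue su2Rep 1 ((L : ℝ) ^ 3 * β) 0) * tubeNormSq (softWeight (χ β)) v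
  hOD : ∀ᶠ β in atTop, ∀ (φ : GaugeConfig 3 1 SU2 → ℝ) (v : GaugeConfig 3 L SU2 → ℝ), Measurable φ → (∃ C : ℝ, ∀ u, |φ u| ≤ C) → (∀ u, φ u ≠ 0 → u ∈ 𝒰 β) →
    Measurable v → (∃ C : ℝ, ∀ U, |v U| ≤ C) → (∀ U, v U ≠ 0 → χ β U ≠ 0) → (∀ u, fibreInner L (softWeight (χ β)) (Ω β) v u = 0) →
    |tubeCross β (boFun L φ (Ω β)) v| ≤ b β * (σ β * levelValue su2Rep 1 ((L : ℝ) ^ 3 * β) 0) *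
        Real.sqrt (tubeNormSq (softWeight (χ β)) (boFun L φ (Ω β))) * Real.sqrt (tubeNormSq (softWeight (χ β)) v) ∧
    |tubeCross β v (boFun L φ (Ω β))| ≤ b β * (σ β * levelValue su2Rep 1 ((L : ℝ) ^ 3 * β) 0) *
        Real.sqrt (tubeNormSq (softWeight (χ β)) (boFun L φ (Ω β))) * Real.sqrt (tubeNormSq (softWeight (χ β)) v)

/-- The inner support of the BO amplitude: if `f` lives where `δc/2 < orbitDist` and the inner shadow holds, `boCoeff f` lives in the one-site annulus `{6t ≤ orbitDist₁}`. [folklore] -/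
theorem boCoeff_inner_support {w : GaugeConfig 3 L SU2 → ℝ} {Ω : LinkSpace L → ℝ} {𝒰 : Set (GaugeConfig 3 1 SU2)} {f : GaugeConfig 3 L SU2 → ℝ} {δc t : ℝ}
    (hfin : ∀ U, f U ≠ 0 → δc / 2 < orbitDist U)
    (hsh : ∀ (u : GaugeConfig 3 1 SU2) (v : Edge 3 L → Fin 3 → ℝ), v ∈ capBalancedSet L → Ω (linkEmbed L v) ≠ 0 → δc / 2 < orbitDist (orthoTube L u v) → 6 * t ≤ orbitDist u)
    (u : GaugeConfig 3 1 SU2) (hu : boCoeff L w Ω 𝒰 f u ≠ 0) : 6 * t ≤ orbitDist u := by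
  by_contra hlt
  apply hu
  have hI : fibreInner L w Ω f u = 0 := by
    unfold fibreInner
    have hae : ∀ᵐ v ∂orthoTransverse L, v ∈ capBalancedSet L := by rw [ae_iff]; exact orthoTransverse_compl_capBalancedSet L
    refine integral_eq_zero_of_ae (hae.mono fun v hv => ?_)
    show f (orthoTube L u v) * Ω (linkEmbed L v) * w (orthoTube L u v) = (0 : (Edge 3 L → Fin 3 → ℝ) → ℝ) v
    by_cases hΩ : Ω (linkEmbed L v) = 0
    · rw [hΩ, mul_zero, zero_mul]; rfl
    · by_cases hf : f (orthoTube L u v) = 0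
      · rw [hf, zero_mul, zero_mul]; rfl
      · exact absurd (hsh u v hv hΩ (hfin _ hf)) hlt
  unfold boCoeff
  by_cases hmem : u ∈ 𝒰
  · rw [Set.indicator_of_mem hmem, hI, zero_div]
  · rw [Set.indicator_of_notMem hmem]

set_option maxHeartbeats 400000 in
/-- ★★★ **THE SUP BOUND ON THE SOFT TUBE, eventually**: from `ShellBricks L χ δc δ`, for every `A`, eventually in `β`, every bounded measurable `f` supported in
`supp χ ∩ {orbitDist < δ} ∩ {δc/2 < orbitDist}` has `T(f) ≤ e^{−A·λ_b(L³β)}·λ₀(β,L)·‖f‖²_{N/χ}`. [cite: Luscher1983, §3] [cite: SjostrandZworski2007, §2] -/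
theorem softTubeGain_of_shellBricks {χ : ℝ → GaugeConfig 3 L SU2 → ℝ} {δc δ : ℝ → ℝ} (K : ShellBricks L χ δc δ) (A : ℝ) :
    ∃ β0 : ℝ, ∀ β : ℝ, β0 ≤ β → ∀ f : GaugeConfig 3 L SU2 → ℝ, Measurable f → (∃ C : ℝ, ∀ U, |f U| ≤ C) →
      (∀ U, f U ≠ 0 → χ β U ≠ 0 ∧ orbitDist U < δ β ∧ δc β / 2 < orbitDist U) →
        tubeForm β f ≤ Real.exp (-(A * bareLambda ((L : ℝ) ^ 3 * β))) * levelValue su2Rep L β 0 * tubeNormSq (softWeight (χ β)) f := by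
  have hL1 : (1 : ℝ) ≤ (L : ℝ) ^ 3 := one_le_pow₀ (by exact_mod_cast NeZero.one_le)
  have hL3 : (0 : ℝ) < (L : ℝ) ^ 3 := by positivity
  obtain ⟨hθ0, hθ1⟩ := K.hθ₀
  -- the one-site annulus gain at `((L : ℝ) ^ 3 * β) = L³β`
  obtain ⟨B₀, hann⟩ := oneSite_annulus_gain_orbitDist
  set A' : ℝ := |A| + 1 with hA'
  have hev : ∀ᶠ β : ℝ in atTop, ∀ f : GaugeConfig 3 L SU2 → ℝ, Measurable f → (∃ C : ℝ, ∀ U, |f U| ≤ C) →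
      (∀ U, f U ≠ 0 → χ β U ≠ 0 ∧ orbitDist U < δ β ∧ δc β / 2 < orbitDist U) →
        tubeForm β f ≤ Real.exp (-(A * bareLambda ((L : ℝ) ^ 3 * β))) * levelValue su2Rep L β 0 * tubeNormSq (softWeight (χ β)) f := by
    filter_upwards [Filter.eventually_ge_atTop (max 1 B₀), K.hδ₁, K.hshadow, K.hshadowIn, K.hbo, K.ht, K.hfloor, K.hdom A', K.hN, K.hT, K.hST, K.hOD]
      with β hβ hδ₁ hshadow hshadowIn hbo ht hfloor hdom hN hT hST hOD
    intro f hfm hfb hfs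
    have hβ1 : 1 ≤ β := (le_max_left _ _).trans hβ
    have hβ0 : 0 < β := by linarith only [hβ1]
    have hβB₀ : B₀ ≤ β := (le_max_right _ _).trans hβ
    have hBβ : β ≤ (L : ℝ) ^ 3 * β := by nlinarith only [hL1, hβ0]
    have hB0 : 0 < ((L : ℝ) ^ 3 * β) := lt_of_lt_of_le hβ0 hBβ
    have hlam0 : 0 < bareLambda ((L : ℝ) ^ 3 * β) := bareLambda_pos' hB0
    have hμ0 : 0 < levelValue su2Rep 1 ((L : ℝ) ^ 3 * β) 0 := levelValue_su2Rep_pos (L := 1) hB0 0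
    have hΛ0 : 0 < levelValue su2Rep L β 0 := levelValue_su2Rep_pos hβ0 0
    obtain ⟨Cw, hCw⟩ := K.hwb β
    obtain ⟨Cf, hCf⟩ := hfb
    -- the gain and the rates
    obtain ⟨ht1, ht2⟩ := ht
    have ht0 : 0 < K.t β := lt_of_lt_of_le (Real.rpow_pos_of_pos hB0 _) ht1
    set g : ℝ := K.t β * Real.sqrt (K.t β) / 80 with hgdef
    have hst1 : Real.sqrt (K.t β) ≤ 1 := Real.sqrt_le_one.mpr (by linarith only [ht2])
    have hg0 : 0 ≤ g := by rw [hgdef]; positivity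
    have hg1 : g ≤ 1 := by
      rw [hgdef]
      have : K.t β * Real.sqrt (K.t β) ≤ 1 / 5000 * 1 := mul_le_mul ht2 hst1 (Real.sqrt_nonneg _) (by norm_num)
      linarith only [this]
    obtain ⟨hdom1, hdom2⟩ := hdom
    have hA'0 : 0 < A' := by rw [hA']; positivity
    have hA'lam : 0 ≤ A' * bareLambda ((L : ℝ) ^ 3 * β) := by positivity
    have hb2 : 0 ≤ 2 * K.b β ^ 2 / K.θ₀ := by positivity
    have hκ0 := K.hκ β
    have hκhalf : K.κ β ≤ 1 / 2 := by
      have : 6 * K.κ β ≤ g := by linarith only [hdom1, hA'lam, hb2]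
      linarith only [this, hg1]
    -- the annulus gain at this `((L : ℝ) ^ 3 * β)`
    have hAG : ∀ G : GaugeConfig 3 1 SU2 → ℝ, Measurable G → (∃ C : ℝ, ∀ u, |G u| ≤ C) →
        (∀ (g' : Site 3 1 → SU2) (u : GaugeConfig 3 1 SU2), G (gaugeTransform g' u) = G u) → (∀ u, G u ≠ 0 → 6 * K.t β ≤ orbitDist u ∧ orbitDist u < 2) →
        qform su2Rep ((L : ℝ) ^ 3 * β) G G ≤ (1 - g) * levelValue su2Rep 1 ((L : ℝ) ^ 3 * β) 0 * l2 G G := fun G hGm hGb _ hGs =>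
      hann ((L : ℝ) ^ 3 * β) (hβB₀.trans hBβ) (K.t β) ht1 ht2 G hGm hGb hGs
    -- (((L : ℝ) ^ 3 * β)-T) upper half
    have hTup : ∀ φ : GaugeConfig 3 1 SU2 → ℝ, Measurable φ → (∃ C : ℝ, ∀ u, |φ u| ≤ C) →
        (∀ (g : Site 3 1 → SU2) (u : GaugeConfig 3 1 SU2), φ (gaugeTransform g u) = φ u) → (∀ u, φ u ≠ 0 → u ∈ K.𝒰 β) →
        tubeForm β (boFun L φ (K.Ω β)) ≤ K.σ β * K.γ β * (1 + K.κ β) * qform su2Rep ((L : ℝ) ^ 3 * β) φ φ +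
          K.κ β * K.σ β * K.γ β * levelValue su2Rep 1 ((L : ℝ) ^ 3 * β) 0 * l2 φ φ :=
      fun φ h1 h2 h3 h4 => by have := (abs_le.mp (hT φ h1 h2 h3 h4)).2; linarith only [this]
    -- supports of `f`
    have hfs1 : ∀ U, f U ≠ 0 → χ β U ≠ 0 := fun U h => (hfs U h).1
    have hfsh : ∀ U, f U ≠ 0 → slowMean L U ∈ K.𝒰 β := fun U h => hshadow U (hfs U h).1 (hfs U h).2.1
    have hfin : ∀ U, f U ≠ 0 → δc β / 2 < orbitDist U := fun U h => (hfs U h).2.2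
    have hφin := boCoeff_inner_support (w := softWeight (χ β)) (𝒰 := K.𝒰 β) hfin hshadowIn
    -- the fixed-`β` split
    have hδ₁2 : K.δ₁ β ≤ 2 := by linarith only [hδ₁]
    have hfix := shell_gain_fixed (K.hwm β) hCw (K.hw0 β) (K.hwinv β) (K.hΩm β) (K.hΩ1 β) (K.hΩinv β) (K.h𝒰m β) (K.h𝒰inv β) (K.h𝒰δ₁ β) hδ₁2
      (K.hσ β).le (K.hγ β) hκ0 hκhalf hN hTup hg0 hg1 hAG hμ0.le hθ0 hST hOD (fun φ U hφ hU => hbo φ U hφ hU) hfm hCf hfs1 hfsh hφin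
    -- endgame: `σμ₀(1 − m) ≤ e^{−Aλ}λ₀`
    set m : ℝ := min (g - 6 * K.κ β - 2 * K.b β ^ 2 / K.θ₀) (K.θ₀ / 2) with hmdef
    have hmA : A' * bareLambda ((L : ℝ) ^ 3 * β) ≤ m := by
      refine le_min ?_ hdom2
      rw [hgdef] at hdom1 ⊢; linarith only [hdom1]
    have hN0 : 0 ≤ tubeNormSq (softWeight (χ β)) f := integral_nonneg fun U => mul_nonneg (sq_nonneg _) (K.hw0 β U)
    have hSg0 : 0 ≤ K.σ β * levelValue su2Rep 1 ((L : ℝ) ^ 3 * β) 0 := mul_nonneg (K.hσ β).le hμ0.le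
    have h1 : 1 - m ≤ Real.exp (-(A' * bareLambda ((L : ℝ) ^ 3 * β))) := by
      have := Real.add_one_le_exp (-m)
      have h2 : Real.exp (-m) ≤ Real.exp (-(A' * bareLambda ((L : ℝ) ^ 3 * β))) := Real.exp_le_exp.mpr (by linarith only [hmA])
      linarith only [this, h2]
    have h3 : K.σ β * levelValue su2Rep 1 ((L : ℝ) ^ 3 * β) 0 ≤ Real.exp (bareLambda ((L : ℝ) ^ 3 * β)) * levelValue su2Rep L β 0 := by
      have e : Real.exp (bareLambda ((L : ℝ) ^ 3 * β)) * (Real.exp (-(bareLambda ((L : ℝ) ^ 3 * β))) * (K.σ β * levelValue su2Rep 1 ((L : ℝ) ^ 3 * β) 0)) = K.σ β * levelValue su2Rep 1 ((L : ℝ) ^ 3 * β) 0 := by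
        rw [← mul_assoc, ← Real.exp_add, add_neg_cancel, Real.exp_zero, one_mul]
      rw [← e]; exact mul_le_mul_of_nonneg_left hfloor (Real.exp_pos _).le
    have h4 : Real.exp (bareLambda ((L : ℝ) ^ 3 * β)) * Real.exp (-(A' * bareLambda ((L : ℝ) ^ 3 * β))) ≤ Real.exp (-(A * bareLambda ((L : ℝ) ^ 3 * β))) := by
      rw [← Real.exp_add]; refine Real.exp_le_exp.mpr ?_
      have hA1 : A * bareLambda ((L : ℝ) ^ 3 * β) ≤ |A| * bareLambda ((L : ℝ) ^ 3 * β) := mul_le_mul_of_nonneg_right (le_abs_self A) hlam0.le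
      rw [hA']; nlinarith only [hA1, hlam0]
    calc tubeForm β f ≤ K.σ β * levelValue su2Rep 1 ((L : ℝ) ^ 3 * β) 0 * (1 - m) * tubeNormSq (softWeight (χ β)) f := hfix
      _ ≤ K.σ β * levelValue su2Rep 1 ((L : ℝ) ^ 3 * β) 0 * Real.exp (-(A' * bareLambda ((L : ℝ) ^ 3 * β))) * tubeNormSq (softWeight (χ β)) f :=
          mul_le_mul_of_nonneg_right (mul_le_mul_of_nonneg_left h1 hSg0) hN0
      _ ≤ Real.exp (bareLambda ((L : ℝ) ^ 3 * β)) * levelValue su2Rep L β 0 * Real.exp (-(A' * bareLambda ((L : ℝ) ^ 3 * β))) * tubeNormSq (softWeight (χ β)) f :=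
          mul_le_mul_of_nonneg_right (mul_le_mul_of_nonneg_right h3 (Real.exp_pos _).le) hN0
      _ = Real.exp (bareLambda ((L : ℝ) ^ 3 * β)) * Real.exp (-(A' * bareLambda ((L : ℝ) ^ 3 * β))) * levelValue su2Rep L β 0 * tubeNormSq (softWeight (χ β)) f := by ring
      _ ≤ Real.exp (-(A * bareLambda ((L : ℝ) ^ 3 * β))) * levelValue su2Rep L β 0 * tubeNormSq (softWeight (χ β)) f :=
          mul_le_mul_of_nonneg_right (mul_le_mul_of_nonneg_right h4 hΛ0.le) hN0
  obtain ⟨β₀, hβ₀⟩ := Filter.eventually_atTop.mp hev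
  exact ⟨β₀, fun β hβ => hβ₀ β hβ⟩

/-- ★★★ **A THIN C4-SHELL FROM ITS BRICKS**: `ShellBricks L χ δc δ → ShellGainOneOrbitAt L δc δ η` (every action scale `η`: the small-action condition is not used).  Slice reduction
(✓`qform_eq_integral_avgKernel`, ✓`l2_eq_sliceFn_left`) of ★★★ `softTubeGain_of_shellBricks`. [cite: Luscher1983, §3] [cite: SeilerLNP1982, §3] -/
theorem shellGainOneOrbitAt_of_shellBricks {χ : ℝ → GaugeConfig 3 L SU2 → ℝ} {δc δ : ℝ → ℝ} (K : ShellBricks L χ δc δ) (η : ℝ → ℝ) :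
    ShellGainOneOrbitAt L δc δ η := by
  obtain ⟨hχm, hχb, β1, hβ1⟩ := K.hadm
  intro A
  obtain ⟨β0, hβ0⟩ := softTubeGain_of_shellBricks K A
  refine ⟨max β0 β1, fun β hβ G hGm hGb hGinv hGsupp => ?_⟩
  have hβ0' : β0 ≤ β := (le_max_left _ _).trans hβ
  obtain ⟨hcov, n₀, hn₀, hNlow⟩ := hβ1 β ((le_max_right _ _).trans hβ)
  obtain ⟨Cχ, hCχ⟩ := hχb β
  obtain ⟨CG, hCG⟩ := hGb
  have hGcov : ∀ U, G U ≠ 0 → gaugeAvg (χ β) U ≠ 0 := fun U hU => (hcov U (hGsupp U hU).2.1).ne'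
  set f : GaugeConfig 3 L SU2 → ℝ := Avg.sliceFn (χ β) G with hf_def
  have h1 := qform_eq_integral_avgKernel β (hχm β) hCχ hn₀ hNlow hGm hCG hGinv hGcov hGm hCG hGinv hGcov
  have h2 := l2_eq_sliceFn_left (hχm β) hCχ hn₀ hNlow hGm hCG hGinv hGcov hGm hCG hGinv
  have hl2 : l2 G G = tubeNormSq (softWeight (χ β)) f := by
    rw [h2]
    unfold l2 tubeNormSq
    refine integral_congr_ae (ae_of_all _ fun U => ?_)
    exact sliceFn_mul_self_eq (ψ := G) hn₀ hNlow U
  have hq : qform su2Rep β G G = tubeForm β f := by rw [h1]; rfl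
  have hfm : Measurable f := Avg.measurable_sliceFn (hχm β) hGm
  have hfb : ∃ C : ℝ, ∀ U, |f U| ≤ C := ⟨CG * Cχ / n₀, Avg.abs_sliceFn_le hCχ hCG hn₀ hNlow⟩
  have hfs : ∀ U, f U ≠ 0 → χ β U ≠ 0 ∧ orbitDist U < δ β ∧ δc β / 2 < orbitDist U := fun U hU =>
    ⟨(Avg.sliceFn_ne_zero hU).1, (hGsupp U (Avg.sliceFn_ne_zero hU).2).2.1, (hGsupp U (Avg.sliceFn_ne_zero hU).2).2.2⟩
  rw [hq, hl2]
  exact hβ0 β hβ0' f hfm hfb hfs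

/-- ★★★ Polynomial radii: `ShellBricks L χ (β^{−a}) (β^{−b})` (`0 < b`) gives the thin shell `InnerShellGainSmallAt L (β^{−a}) (β^{−b}) (β^{−q})` for every `q`. [cite: Luscher1983, §3] -/
theorem innerShellGainSmallAt_of_shellBricks {χ : ℝ → GaugeConfig 3 L SU2 → ℝ} {a b q : ℝ} (hb : 0 < b) (K : ShellBricks L χ (powScale a) (powScale b)) :
    InnerShellGainSmallAt L (powScale a) (powScale b) (powScale q) :=
  innerShellGainSmallAt_pow_of_oneOrbit hb (shellGainOneOrbitAt_of_shellBricks K (powScale q))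

end Summit.QuantumFields.YangMills.Theorems.FemtoTransferGap.TwoLattice.ConstTube

end
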